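import Summits.QuantumFields.YangMills.Theorems.AtomicSynthesisSlotSynthIteration

/-!
# Weighted atomic synthesis (for the tempered E3T stub of leaf 19868), part 1: one round with contraction `θ^{K+5}`,
stages, telescoping, geometric WEIGHTED mass bounds

Free-hands helper toward the registered stub E3T `stub_temperedMomentBoundA : WhitneyPkgW → AtomicSqrtDominationR →
TemperedMomentBoundA` of LINES «TemperedPeak» REV 2 / «OctaveDoubling» REV 2.1 on the leaf
`InfiniteVolumeContinuum.HypercubicOSDataFromInfiniteVolume` (stmt-QuantumFields-19868).  The tempered hypothesis of
TMB-A charges an atom of physical size `σ` the level `ε σ^{-M}`, so the atomic synthesis (crux 28126, landed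
`atomicSynthesis_proof'`) must be re-run with the WEIGHTED mass `Σ_i |coef_i| (ρ/σ_i)^K` under control.  The landed
single-slot iteration (`SingleSlotPlan.OneStep`, contraction `θ^5` per round) gives geometric decay `θ^r` of the round
masses only; here the one-round property is `OneStepW b N K θ C R` with contraction `θ^{K+5}` (available at moment order
`N = K + 6`, part 3), and the round-`r` atoms (scale `θ^{r+1}σ₀`) have weighted mass `≤ const · θ^r`.
This part is the twin of `AtomicSynthesisSlotSynthIteration` with the exponent carried: stages (the tree's `Stage`),
rounds, telescoping, uniform convergence of the residuals, the weighted geometric mass bound `wmass_le_geom`, and the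
pointwise sum over rounds.  Elementary real analysis; no stub/crux/rung/summit is closed by this file; the YM mass gap
is NOT proved. [folklore]
-/

set_option autoImplicit false

noncomputable section

open scoped BigOperators Topology ContDiff
open MeasureTheory Filter Metric
open Summit.QuantumFields.YangMills.Cruxes.AtomicSynthesis.SingleSlotPlan (E4 Stage)

namespace Summit.QuantumFields.YangMills.Theorems.AtomicSynthesisWeighted

/-- One round of atomic synthesis at scale ratio `θ` with the STRONGER contraction `θ^{K+5}` (the tree's `OneStep` is the
case `K = 0`): a `C^N`-controlled `f` supported in `B̄(c, ϱ)` at scale `σ` is, up to a residual with amplitude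
`θ^{K+5} A` at scale `θσ`, a finite combination of `b`-atoms of scale `θσ` with mass `≤ C (ϱ/(θσ))⁴ A`. [folklore] -/
def OneStepW (b : SchwartzMap E4 ℝ) (N K : ℕ) (θ C R : ℝ) : Prop :=
  ∀ (f : E4 → ℝ) (c : E4) (ϱ σ A : ℝ), ContDiff ℝ ∞ f → 0 < σ → σ ≤ ϱ → 0 ≤ A →
    tsupport f ⊆ closedBall c ϱ →
    (∀ m : ℕ, m ≤ N → ∀ z, ‖iteratedFDeriv ℝ m f z‖ ≤ A / σ ^ m) →
    ∃ (J : ℕ) (a : Fin J → ℝ) (η : Fin J → E4),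
      (∀ j, ‖η j - c‖ ≤ ϱ + R * (θ * σ)) ∧
      (∑ j, |a j| ≤ C * (ϱ / (θ * σ)) ^ 4 * A) ∧
      ContDiff ℝ ∞ (fun z => f z - ∑ j, a j * b ((θ * σ)⁻¹ • (z - η j))) ∧
      tsupport (fun z => f z - ∑ j, a j * b ((θ * σ)⁻¹ • (z - η j))) ⊆ closedBall c (ϱ + R * (θ * σ)) ∧
      ∀ m : ℕ, m ≤ N → ∀ z,
        ‖iteratedFDeriv ℝ m (fun z => f z - ∑ j, a j * b ((θ * σ)⁻¹ • (z - η j))) z‖ ≤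
          θ ^ (K + 5) * A / (θ * σ) ^ m

/-- `OneStepW` at `K` implies the tree's `OneStep` (`θ^{K+5} ≤ θ^5` for `θ ≤ 1`). -/
theorem oneStep_of_oneStepW {b : SchwartzMap E4 ℝ} {N K : ℕ} {θ C R : ℝ} (hθ : 0 < θ) (hθ1 : θ ≤ 1)
    (h : OneStepW b N K θ C R) :
    Summit.QuantumFields.YangMills.Cruxes.AtomicSynthesis.SingleSlotPlan.OneStep b N θ C R := by
  intro f c ϱ σ A hf hσ hσϱ hA hsupp hbd
  obtain ⟨J, a, η, h1, h2, h3, h4, h5⟩ := h f c ϱ σ A hf hσ hσϱ hA hsupp hbd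
  refine ⟨J, a, η, h1, h2, h3, h4, fun m hm z => (h5 m hm z).trans ?_⟩
  have hθK : θ ^ (K + 5) ≤ θ ^ 5 := pow_le_pow_of_le_one hθ.le hθ1 (by omega)
  exact div_le_div_of_nonneg_right (mul_le_mul_of_nonneg_right hθK hA) (pow_nonneg (mul_pos hθ hσ).le m)

section Iteration

variable {b : SchwartzMap E4 ℝ} {N K : ℕ} {θ C R : ℝ} {c : E4}

/-- The atoms produced by one weighted round applied to a stage (chosen by `Classical.choice`). -/
structure RoundW (b : SchwartzMap E4 ℝ) (N K : ℕ) (θ C R : ℝ) (c : E4) (S : Stage N c) where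
  J : ℕ
  a : Fin J → ℝ
  η : Fin J → E4
  hη : ∀ j, ‖η j - c‖ ≤ S.ϱ + R * (θ * S.σ)
  hmass : ∑ j, |a j| ≤ C * (S.ϱ / (θ * S.σ)) ^ 4 * S.A
  hf' : ContDiff ℝ ∞ (fun z => S.f z - ∑ j, a j * b ((θ * S.σ)⁻¹ • (z - η j)))
  hsupp' : tsupport (fun z => S.f z - ∑ j, a j * b ((θ * S.σ)⁻¹ • (z - η j))) ⊆ closedBall c (S.ϱ + R * (θ * S.σ))
  hbd' : ∀ m : ℕ, m ≤ N → ∀ z,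
    ‖iteratedFDeriv ℝ m (fun z => S.f z - ∑ j, a j * b ((θ * S.σ)⁻¹ • (z - η j))) z‖ ≤
      θ ^ (K + 5) * S.A / (θ * S.σ) ^ m

/-- One weighted round exists at every stage. -/
theorem nonempty_roundW (h : OneStepW b N K θ C R) (S : Stage N c) : Nonempty (RoundW b N K θ C R c S) := by
  obtain ⟨J, a, η, h1, h2, h3, h4, h5⟩ := h S.f c S.ϱ S.σ S.A S.hf S.hσ S.hσϱ S.hA S.hsupp S.hbd
  exact ⟨⟨J, a, η, h1, h2, h3, h4, h5⟩⟩

/-- The chosen weighted round. -/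
def roundW (h : OneStepW b N K θ C R) (S : Stage N c) : RoundW b N K θ C R c S :=
  Classical.choice (nonempty_roundW h S)

/-- The next stage of the weighted iteration (amplitude `θ^{K+5} A`). -/
def nextW (h : OneStepW b N K θ C R) (hθ : 0 < θ) (hθ1 : θ ≤ 1) (hR : 0 ≤ R) (S : Stage N c) : Stage N c where
  f := fun z => S.f z - ∑ j, (roundW h S).a j * b ((θ * S.σ)⁻¹ • (z - (roundW h S).η j))
  ϱ := S.ϱ + R * (θ * S.σ)
  σ := θ * S.σ
  A := θ ^ (K + 5) * S.A
  hf := (roundW h S).hf'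
  hσ := mul_pos hθ S.hσ
  hσϱ := by
    have h1 : θ * S.σ ≤ S.σ := by nlinarith [S.hσ]
    have h2 : 0 ≤ R * (θ * S.σ) := mul_nonneg hR (mul_nonneg hθ.le S.hσ.le)
    linarith [S.hσϱ]
  hA := mul_nonneg (pow_nonneg hθ.le _) S.hA
  hsupp := (roundW h S).hsupp'
  hbd := (roundW h S).hbd'

/-- The `r`-th stage of the weighted iteration. -/
def stageW (h : OneStepW b N K θ C R) (hθ : 0 < θ) (hθ1 : θ ≤ 1) (hR : 0 ≤ R) (S₀ : Stage N c) : ℕ → Stage N c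
  | 0 => S₀
  | r + 1 => nextW h hθ hθ1 hR (stageW h hθ hθ1 hR S₀ r)

/-- The scale after `r` weighted rounds is `θ^r σ₀`. -/
theorem stageW_σ (h : OneStepW b N K θ C R) (hθ : 0 < θ) (hθ1 : θ ≤ 1) (hR : 0 ≤ R) (S₀ : Stage N c) (r : ℕ) :
    (stageW h hθ hθ1 hR S₀ r).σ = θ ^ r * S₀.σ := by
  induction r with
  | zero => simp [stageW]
  | succ r ih => simp [stageW, nextW, ih, pow_succ]; ring

/-- The amplitude after `r` weighted rounds is `θ^{(K+5)r} A₀`. -/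
theorem stageW_A (h : OneStepW b N K θ C R) (hθ : 0 < θ) (hθ1 : θ ≤ 1) (hR : 0 ≤ R) (S₀ : Stage N c) (r : ℕ) :
    (stageW h hθ hθ1 hR S₀ r).A = θ ^ ((K + 5) * r) * S₀.A := by
  induction r with
  | zero => simp [stageW]
  | succ r ih =>
    simp only [stageW, nextW, ih]
    rw [show (K + 5) * (r + 1) = (K + 5) + (K + 5) * r by ring, pow_add]
    ring

/-- The support-radius invariant of the weighted iteration: `ϱ_r + R θ σ_r/(1−θ)` is constant. -/
theorem stageW_ϱ_inv (h : OneStepW b N K θ C R) (hθ : 0 < θ) (hθ1 : θ < 1) (hR : 0 ≤ R) (S₀ : Stage N c) (r : ℕ) :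
    (stageW h hθ hθ1.le hR S₀ r).ϱ + R * θ * (stageW h hθ hθ1.le hR S₀ r).σ / (1 - θ) =
      S₀.ϱ + R * θ * S₀.σ / (1 - θ) := by
  induction r with
  | zero => simp [stageW]
  | succ r ih =>
    rw [← ih]
    simp only [stageW, nextW]
    have h1 : (1 - θ) ≠ 0 := by linarith
    field_simp
    ring

/-- The support radius of the weighted iteration never exceeds `ϱ₀ + R θ σ₀/(1−θ)`. -/
theorem stageW_ϱ_le (h : OneStepW b N K θ C R) (hθ : 0 < θ) (hθ1 : θ < 1) (hR : 0 ≤ R) (S₀ : Stage N c) (r : ℕ) :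
    (stageW h hθ hθ1.le hR S₀ r).ϱ + R * (θ * (stageW h hθ hθ1.le hR S₀ r).σ) ≤
      S₀.ϱ + R * θ * S₀.σ / (1 - θ) := by
  have hinv := stageW_ϱ_inv h hθ hθ1 hR S₀ r
  set S := stageW h hθ hθ1.le hR S₀ r
  have h1 : 0 < 1 - θ := by linarith
  have hx : 0 ≤ R * θ * S.σ := mul_nonneg (mul_nonneg hR hθ.le) S.hσ.le
  have : R * (θ * S.σ) ≤ R * θ * S.σ / (1 - θ) := by
    rw [le_div_iff₀ h1]; nlinarith
  linarith

end Iteration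


section Telescoping

variable {b : SchwartzMap E4 ℝ} {N K : ℕ} {θ C R : ℝ} {c : E4}
variable (h : OneStepW b N K θ C R) (hθ : 0 < θ) (hθ1 : θ < 1) (hR : 0 ≤ R) (S₀ : Stage N c)

/-- The atoms of weighted round `r`. -/
def atomW (r : ℕ) (j : Fin (roundW h (stageW h hθ hθ1.le hR S₀ r)).J) (z : E4) : ℝ :=
  (roundW h (stageW h hθ hθ1.le hR S₀ r)).a j *
    b ((θ * (stageW h hθ hθ1.le hR S₀ r).σ)⁻¹ • (z - (roundW h (stageW h hθ hθ1.le hR S₀ r)).η j))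

/-- The residual after weighted round `r+1` is the residual after round `r` minus the atoms of round `r`. -/
theorem stageW_succ_f (r : ℕ) (z : E4) :
    (stageW h hθ hθ1.le hR S₀ (r + 1)).f z =
      (stageW h hθ hθ1.le hR S₀ r).f z - ∑ j, atomW h hθ hθ1 hR S₀ r j z := by
  simp [stageW, nextW, atomW]

/-- Telescoping of the weighted iteration: `ψ − f_n = Σ_{r<n} Σ_j atomW_{r,j}`. -/
theorem telescopeW (n : ℕ) (z : E4) :
    S₀.f z - (stageW h hθ hθ1.le hR S₀ n).f z = ∑ r ∈ Finset.range n, ∑ j, atomW h hθ hθ1 hR S₀ r j z := by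
  induction n with
  | zero => simp [stageW]
  | succ n ih => rw [Finset.sum_range_succ, ← ih, stageW_succ_f h hθ hθ1 hR S₀ n z]; ring

/-- The residual of the weighted iteration is bounded by its amplitude: `|f_n z| ≤ θ^{(K+5)n} A₀`. -/
theorem abs_stageW_f_le (n : ℕ) (z : E4) :
    |(stageW h hθ hθ1.le hR S₀ n).f z| ≤ θ ^ ((K + 5) * n) * S₀.A := by
  have := (stageW h hθ hθ1.le hR S₀ n).hbd 0 (Nat.zero_le _) z
  rw [norm_iteratedFDeriv_zero, pow_zero, div_one, stageW_A] at this
  simpa [Real.norm_eq_abs] using this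

/-- The residual of the weighted iteration tends to zero pointwise. -/
theorem tendsto_stageW_f (z : E4) : Tendsto (fun n => (stageW h hθ hθ1.le hR S₀ n).f z) atTop (𝓝 0) := by
  have hg : Tendsto (fun n : ℕ => θ ^ ((K + 5) * n) * S₀.A) atTop (𝓝 0) := by
    have h1 : Tendsto (fun n : ℕ => (θ ^ (K + 5)) ^ n) atTop (𝓝 0) :=
      tendsto_pow_atTop_nhds_zero_of_lt_one (pow_nonneg hθ.le _) (pow_lt_one₀ hθ.le hθ1 (by omega))
    have := h1.mul_const S₀.A
    simpa [← pow_mul, zero_mul] using this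
  exact squeeze_zero_norm (fun n => by simpa [Real.norm_eq_abs] using abs_stageW_f_le h hθ hθ1 hR S₀ n z) hg

/-- Mass of weighted round `r`: `Σ_j |a_{r,j}| ≤ C (P/(θ^{r+1}σ₀))⁴ θ^{(K+5)r} A₀`, `P := ϱ₀ + Rθσ₀/(1−θ)`. -/
theorem massW_le (r : ℕ) (hC : 0 ≤ C) :
    ∑ j, |(roundW h (stageW h hθ hθ1.le hR S₀ r)).a j| ≤
      C * ((S₀.ϱ + R * θ * S₀.σ / (1 - θ)) / (θ ^ (r + 1) * S₀.σ)) ^ 4 * (θ ^ ((K + 5) * r) * S₀.A) := by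
  set S := stageW h hθ hθ1.le hR S₀ r with hS
  have hm := (roundW h S).hmass
  have hϱ : S.ϱ ≤ S₀.ϱ + R * θ * S₀.σ / (1 - θ) := by
    have := stageW_ϱ_le h hθ hθ1 hR S₀ r
    have hx : 0 ≤ R * (θ * S.σ) := mul_nonneg hR (mul_nonneg hθ.le S.hσ.le)
    rw [← hS] at this; linarith
  have hσ : θ * S.σ = θ ^ (r + 1) * S₀.σ := by rw [hS, stageW_σ]; ring
  have hA : S.A = θ ^ ((K + 5) * r) * S₀.A := by rw [hS, stageW_A]
  rw [hσ] at hm; rw [hA] at hm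
  refine hm.trans ?_
  have hpos : 0 < θ ^ (r + 1) * S₀.σ := mul_pos (pow_pos hθ _) S₀.hσ
  have hϱ0 : 0 ≤ S.ϱ := S.hσ.le.trans S.hσϱ
  gcongr
  · exact mul_nonneg (pow_nonneg hθ.le _) S₀.hA

/-- **Weighted geometric mass bound of round `r`.**  The atoms of round `r` have scale `θ^{r+1}σ₀`; their mass times the
weight `(θ^{r+1}σ₀)^{-K}` is `≤ C (P/(θσ₀))⁴ A₀ (θσ₀)^{-K} · θ^r` — the extra contraction `θ^{Kr}` of `OneStepW` exactly
pays the weight. -/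
theorem wmassW_le_geom (r : ℕ) (hC : 0 ≤ C) :
    (∑ j, |(roundW h (stageW h hθ hθ1.le hR S₀ r)).a j|) * ((θ ^ (r + 1) * S₀.σ) ^ K)⁻¹ ≤
      (C * ((S₀.ϱ + R * θ * S₀.σ / (1 - θ)) / (θ * S₀.σ)) ^ 4 * S₀.A * ((θ * S₀.σ) ^ K)⁻¹) * θ ^ r := by
  have h2 := massW_le h hθ hθ1 hR S₀ r hC
  have hθ0 : θ ≠ 0 := hθ.ne'
  have hσ0 : S₀.σ ≠ 0 := S₀.hσ.ne'
  have hw0 : 0 ≤ ((θ ^ (r + 1) * S₀.σ) ^ K)⁻¹ := inv_nonneg.2 (pow_nonneg (mul_pos (pow_pos hθ _) S₀.hσ).le K)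
  refine (mul_le_mul_of_nonneg_right h2 hw0).trans (le_of_eq ?_)
  have e1 : θ ^ ((K + 5) * r) = θ ^ (K * r) * θ ^ (4 * r) * θ ^ r := by
    rw [← pow_add, ← pow_add]; congr 1; ring
  have e2 : (θ ^ (r + 1) * S₀.σ) ^ K = θ ^ (K * r) * (θ * S₀.σ) ^ K := by
    rw [mul_pow, mul_pow, ← pow_mul, ← mul_assoc, ← pow_add]
    congr 2; ring
  have e3 : (θ ^ (r + 1) * S₀.σ) ^ 4 = θ ^ (4 * r) * (θ * S₀.σ) ^ 4 := by
    rw [mul_pow, mul_pow, ← pow_mul, ← mul_assoc, ← pow_add]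
    congr 2; ring
  rw [e1, e2, div_pow, div_pow, e3]
  have hKr : θ ^ (K * r) ≠ 0 := pow_ne_zero _ hθ0
  have h4r : θ ^ (4 * r) ≠ 0 := pow_ne_zero _ hθ0
  have hts : (θ * S₀.σ) ^ K ≠ 0 := pow_ne_zero _ (mul_ne_zero hθ0 hσ0)
  have hts4 : (θ * S₀.σ) ^ 4 ≠ 0 := pow_ne_zero _ (mul_ne_zero hθ0 hσ0)
  field_simp

/-- Pointwise: the weighted atom series over rounds sums to `ψ z` (absolutely, by the unweighted mass bounds). -/
theorem hasSum_roundsW (hC : 0 ≤ C) (z : E4) :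
    HasSum (fun r => ∑ j, atomW h hθ hθ1 hR S₀ r j z) (S₀.f z) := by
  -- sup bound on `b`
  obtain ⟨B, hBpos, hB⟩ := b.decay 0 0
  have hB' : ∀ x, |b x| ≤ B := fun x => by simpa [norm_iteratedFDeriv_zero, Real.norm_eq_abs] using hB x
  have hB0 : 0 ≤ B := hBpos.le
  -- geometric majorant (the weight is ≥ 1, so the unweighted mass is also geometric)
  set P := S₀.ϱ + R * θ * S₀.σ / (1 - θ) with hP
  set Kc := C * (P / (θ * S₀.σ)) ^ 4 * S₀.A * ((θ * S₀.σ) ^ K)⁻¹ * B with hKc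
  have hmaj : ∀ r, ‖∑ j, atomW h hθ hθ1 hR S₀ r j z‖ ≤ Kc * θ ^ r * ((θ ^ (r + 1) * S₀.σ) ^ K) := by
    intro r
    rw [Real.norm_eq_abs]
    refine (Finset.abs_sum_le_sum_abs _ _).trans ?_
    have h1 : ∑ j, |atomW h hθ hθ1 hR S₀ r j z| ≤ (∑ j, |(roundW h (stageW h hθ hθ1.le hR S₀ r)).a j|) * B := by
      rw [Finset.sum_mul]
      refine Finset.sum_le_sum fun j _ => ?_
      rw [atomW, abs_mul]
      exact mul_le_mul_of_nonneg_left (hB' _) (abs_nonneg _)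
    refine h1.trans ?_
    have hwpos : 0 < (θ ^ (r + 1) * S₀.σ) ^ K := pow_pos (mul_pos (pow_pos hθ _) S₀.hσ) K
    have h2 := wmassW_le_geom h hθ hθ1 hR S₀ r hC
    rw [← hP] at h2
    have h3 : ∑ j, |(roundW h (stageW h hθ hθ1.le hR S₀ r)).a j| ≤
        (C * (P / (θ * S₀.σ)) ^ 4 * S₀.A * ((θ * S₀.σ) ^ K)⁻¹) * θ ^ r * (θ ^ (r + 1) * S₀.σ) ^ K := by
      have := mul_le_mul_of_nonneg_right h2 hwpos.le
      rwa [mul_assoc (∑ j, _), inv_mul_cancel₀ hwpos.ne', mul_one] at this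
    calc (∑ j, |(roundW h (stageW h hθ hθ1.le hR S₀ r)).a j|) * B
        ≤ ((C * (P / (θ * S₀.σ)) ^ 4 * S₀.A * ((θ * S₀.σ) ^ K)⁻¹) * θ ^ r * (θ ^ (r + 1) * S₀.σ) ^ K) * B :=
          mul_le_mul_of_nonneg_right h3 hB0
      _ = Kc * θ ^ r * ((θ ^ (r + 1) * S₀.σ) ^ K) := by rw [hKc]; ring
  -- the weights are bounded by `(σ₀)^K ≤ max 1 σ₀^K`; use the cruder majorant `Kc (max 1 (S₀.σ ^ K)) θ^r`
  have hmaj' : ∀ r, ‖∑ j, atomW h hθ hθ1 hR S₀ r j z‖ ≤ Kc * max 1 (S₀.σ ^ K) * θ ^ r := by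
    intro r
    refine (hmaj r).trans ?_
    have hKc0 : 0 ≤ Kc := by
      rw [hKc]
      refine mul_nonneg (mul_nonneg (mul_nonneg (mul_nonneg hC (pow_nonneg ?_ 4)) S₀.hA)
        (inv_nonneg.2 (pow_nonneg (mul_pos hθ S₀.hσ).le K))) hB0
      refine div_nonneg ?_ (mul_pos hθ S₀.hσ).le
      rw [hP]
      exact add_nonneg (S₀.hσ.le.trans S₀.hσϱ)
        (div_nonneg (mul_nonneg (mul_nonneg hR hθ.le) S₀.hσ.le) (by linarith))
    have hw : (θ ^ (r + 1) * S₀.σ) ^ K ≤ max 1 (S₀.σ ^ K) := by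
      rw [mul_pow]
      have h1 : (θ ^ (r + 1)) ^ K ≤ 1 := pow_le_one₀ (pow_nonneg hθ.le _) (pow_le_one₀ hθ.le hθ1.le)
      calc (θ ^ (r + 1)) ^ K * S₀.σ ^ K ≤ 1 * S₀.σ ^ K :=
            mul_le_mul_of_nonneg_right h1 (pow_nonneg S₀.hσ.le K)
        _ ≤ max 1 (S₀.σ ^ K) := by rw [one_mul]; exact le_max_right _ _
    calc Kc * θ ^ r * (θ ^ (r + 1) * S₀.σ) ^ K ≤ Kc * θ ^ r * max 1 (S₀.σ ^ K) :=
          mul_le_mul_of_nonneg_left hw (by positivity)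
      _ = Kc * max 1 (S₀.σ ^ K) * θ ^ r := by ring
  have hsum : Summable (fun r => ∑ j, atomW h hθ hθ1 hR S₀ r j z) :=
    Summable.of_norm_bounded (g := fun r => Kc * max 1 (S₀.σ ^ K) * θ ^ r)
      ((summable_geometric_of_lt_one hθ.le hθ1).mul_left _) hmaj'
  rw [hsum.hasSum_iff_tendsto_nat]
  have ht : Tendsto (fun n => S₀.f z - (stageW h hθ hθ1.le hR S₀ n).f z) atTop (𝓝 (S₀.f z - 0)) :=
    tendsto_const_nhds.sub (tendsto_stageW_f h hθ hθ1 hR S₀ z)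
  rw [sub_zero] at ht
  refine ht.congr fun n => ?_
  rw [telescopeW]

end Telescoping


section FlattenDefs

variable {b : SchwartzMap E4 ℝ} {N K : ℕ} {θ C R : ℝ} {c : E4}
variable (h : OneStepW b N K θ C R) (hθ : 0 < θ) (hθ1 : θ < 1) (hR : 0 ≤ R) (S₀ : Stage N c)

/-- The index type of all atoms of the weighted iteration: (round, atom). -/
abbrev IdxW : Type := Σ r : ℕ, Fin (roundW h (stageW h hθ hθ1.le hR S₀ r)).J

/-- Coefficient of the atom with flattened index `i` (weighted iteration). -/
def coefTW (i : IdxW h hθ hθ1 hR S₀) : ℝ := (roundW h (stageW h hθ hθ1.le hR S₀ i.1)).a i.2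
/-- Scale of the atom with flattened index `i` (weighted iteration): `θ^{r+1} σ₀`. -/
def scaleTW (i : IdxW h hθ hθ1 hR S₀) : ℝ := θ * (stageW h hθ hθ1.le hR S₀ i.1).σ
/-- Centre of the atom with flattened index `i` (weighted iteration). -/
def centreTW (i : IdxW h hθ hθ1 hR S₀) : E4 := (roundW h (stageW h hθ hθ1.le hR S₀ i.1)).η i.2

/-- The atom with flattened index `i`, written with `coefTW`/`scaleTW`/`centreTW`. -/
theorem atomW_eq (i : IdxW h hθ hθ1 hR S₀) (z : E4) :
    coefTW h hθ hθ1 hR S₀ i * b ((scaleTW h hθ hθ1 hR S₀ i)⁻¹ • (z - centreTW h hθ hθ1 hR S₀ i)) =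
      atomW h hθ hθ1 hR S₀ i.1 i.2 z := rfl

/-- Extension by a default value along the encoding of the (countable) index type `IdxW` into `ℕ`. -/
def extW {X : Type} (g : IdxW h hθ hθ1 hR S₀ → X) (d : X) (n : ℕ) : X :=
  (Encodable.decode₂ (IdxW h hθ hθ1 hR S₀) n).elim d g

end FlattenDefs

/-- **Weighted single-slot synthesis** with constants `C₁, N₁` and weight exponent `K`: every Schwartz `ψ` on `ℝ⁴`
supported in `B̄(c, 3ρ/2)` with `ρ^m ‖D^m ψ‖ ≤ M'` (`m ≤ N₁`) is an `ℓ¹` series of `b`-atoms of scales `σ_i ≤ ρ` centred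
within `2ρ` of `c`, with WEIGHTED mass `Σ_i |a_i| (ρ/σ_i)^K ≤ C₁ M'` (the tree's `SlotSynth b C₁ N₁` is `K = 0`).
[folklore] -/
def SlotSynthW (b : SchwartzMap E4 ℝ) (C₁ : ℝ) (N₁ K : ℕ) : Prop :=
  ∀ (ψ : SchwartzMap E4 ℝ) (c : E4) (ρ M' : ℝ), 0 < ρ →
    tsupport ψ ⊆ closedBall c (3 / 2 * ρ) →
    (∀ m : ℕ, m ≤ N₁ → ∀ z, ‖iteratedFDeriv ℝ m ψ z‖ ≤ M' / ρ ^ m) →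
    ∃ (a : ℕ → ℝ) (σ : ℕ → ℝ) (η : ℕ → E4),
      Summable (fun i => |a i| * (ρ / σ i) ^ K) ∧ ∑' i, |a i| * (ρ / σ i) ^ K ≤ C₁ * M' ∧
      (∀ i, 0 < σ i ∧ σ i ≤ ρ ∧ ‖η i - c‖ ≤ 2 * ρ) ∧
      ∀ z, ψ z = ∑' i, a i * b ((σ i)⁻¹ • (z - η i))

end Summit.QuantumFields.YangMills.Theorems.AtomicSynthesisWeighted

end
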